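/-
Copyright (c) 2026 the pub-hodgecm2 formalisation cell (harness21).  New file, outside the frozen port manifest.
Origin: seat `prover-pub-hodgecm2-d2bridge-wb-11-g0-0` (WALL-BREAKER 11, sub-socket S-c «transport `ComponentAlbanese`@ῑ₁ → @ι₁ along
S-a/S-b», TRANSPORT route, pair wb-1), 2026-08-23.  THEOREMS ONLY (kernel lane): no definition, no instance, no named fact, no `variable`
carrying a Prop, no `sorry`, no new axiom.  HC_CM is NOT proved; «Δ2 BRIDGE CLOSED» is NOT claimed.

VERDICT carried by this file (S-c, DECISION #13 / ORIENTATION-MEMO v1.3): the seam-closing reading of S-c — an instance-only transport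
`ComponentAlbanese … V h Φ C T` from `[ῑ₁.toAlgebra]` to `[ι₁.toAlgebra]` over the END's fixed data — has NO constructible content: the
target `((C.A K).baseChange ℂ).X` read through `ῑ₁` is the complex-CONJUGATE `ℂ`-scheme of the one read through `ι₁` (real
`Over.pullback` along `Spec (starRingEnd ℂ)`), so a re-targeting would be a `ℂ`-morphism out of the conjugate surface `P_Γ(V)^c`, which the
tree does not identify with any tree surface; and the full relabelling `(V, ι₁, Φ, C, T, inst) ↦ (V̄, ῑ₁, Φ̄, C^{(c)}, T^{(c)}, inst ∘ c)`
needs a `c`-twist of `Sec42Data` the tree does not have and MOVES the seam instead of removing it (the S1 junction then asks for the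
instance the cofan does not give, at the conjugate pin).  What DOES transport, literally, is the SOURCE side of `ComponentAlbanese` —
the Picard codes, hence the realised surfaces `U.pms`, hence their cohomology — and that is what is proved here:

* §1 `picardCode_eq_of_complex_data` — a Picard code remembers only `E ⊆ ℂ`, its Gram matrix READ IN `ℂ` and its group READ IN `GL₃(ℂ)`.
* §2 `pmsCode_eq_of_complex_data` (tree copy `CorCM.Model.pmsCode`) and `pkg_pmsCode_eq_of_complex_data` (ported copy
  `HodgeCM.Model.pmsCode`, the END's currency), ACROSS fields `L`, `L'`: equal code fields, equal complex Gram matrices, equal complex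
  groups ⟹ equal codes; `pkg_pms_eq_of_complex_data`: hence the SAME variety `U.pms` of the model universe.
* §3 `pmsCode_relabel` — relabelling along any `h : L ≃+* L` (`HermSpace3.relabel`, `Level.relabel` of `CorCM/HermSpaceRelabel`) does not
  change the code: the LITERAL form of `TowerRelabel.exists_hom_pms_relabel` (which gave an isomorphism via uniformisation-uniqueness).
* §4 the conjugate presentation in the END's currency: for ANY `V' : HodgeCM.HermSpace3 L ῑ₁`, `Γ' : HodgeCM.Level V'` with the
  TRANSPOSED-CONJUGATE data `V'.Hm = c(V.Hm)`, `Γ'.Γ = c(Γ.Γ)` — `pkg_pmsCode_conj`, `pkg_pms_conj`: the `(V', ῑ₁)`-surface at `Γ'` IS the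
  `(V, ι₁)`-surface at `Γ` (same `Var`); `exists_conjPresentation`: such `(V', Γ')` exist (non-vacuity witness, built from the tree's
  `HermSpace3.relabel` at `h := c` through the PORT JOIN maps and `ι₁ ∘ c⁻¹ = conj ∘ ι₁`).  This answers wb-1 (2c) ∕ wb-5 (F3)(b) in the
  kernel: YES for the transposed-conjugate datum; for the «same Gram matrix at ῑ₁» datum the complex Gram matrix is `conj (V.Hm^{ι₁})`
  and §1 does not apply (conjugate ball).
* §5 `algebraMap_comp_cmConj_eq_iff` — the one-line dictionary between prove-5's instance hypothesis
  `(algebraMap L ℂ).comp (cmConjRingHom L) = ι₁` (`ComponentAlbanesePin`) and prove-3's `∀ x, algebraMap L ℂ x = ῑ₁ x` (`HcmPiecesAtPin`,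
  `ιg := ῑ₁`): NO structure transport is needed between the J value and its consumer — the seam is `hadmμ`, not J's type.

REPAIR CENSUS for S-c (attempted-with-result ∕ not-attempted-with-reason), recorded for the ASSEMBLER: (1) instance-only transport via
`baseChangeHomObjIsoOfComp` — re-targets to the conjugate `L`-model, not to `C.A K` (no free `A` slot) ✗; (2) via an antiholomorphic
involution of `P_Γ(V)` — needs `V.Hm ∈ M₃(L⁺)`, `c(Γ) = Γ` and a «conjugate of a uniformised variety» theorem, none in the tree, and the END
quantifies every `V` ✗; (3) cohomological shadow only (`pull (alb K g) 1` through `H¹(A ⊗_{ι₁} ℂ) = H¹(A ⊗_{ῑ₁} ℂ)`, wb-1's file) —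
`HcmPieces.f_of ∕ geom_eq` need honest `ℂ`-morphisms `P_Γ ⟶ (dLiu q).A.X` ✗; (4) conjugating the eigenclass (`α ↦ ᾱ`, `τ ↦ conj ∘ τ`) —
admissible for `Φ̄_{μ_i}`, not `Φ_{μ_i}` ✗; (5) feeding line `i` from `𝒜(μ_i^c)` — the Ω-slot pins `HasCMType (μ i) (line i).lineType ∋ ι₁` ✗;
(6) full relabel with `C^{(c)} := cast C` — `honestP5Of h F ι V Φ` reads `V`, the `Sec42Data` types differ ✗; (7) Φ-only transport
`… Φ C T → … Φ̄ C T` — TRUE by `rfl` (`honestP5Of` discards `Φ`), useful only once `adm` is re-keyed (branch T-ῑ) ✓; (8) = §5 ✓.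
-/
import Summits.HodgeConjecture.CorCM.HermSpaceRelabel
import Summits.HodgeConjecture.CorCM.Model.Universe
import Summits.HodgeConjecture.CorCM.PortJoin.Universe
import Summits.HodgeConjecture.HodgeCM.Model.Universe
import HarnessLib

set_option autoImplicit false

/-!
# Δ2 bridge, sub-socket S-c (transport half that EXISTS): Picard codes, hence tree surfaces, are invariant under relabelling
# of `(L, ι₁, V, Γ)` through `ℂ` — in particular under the conjugate presentation `(V̄, ῑ₁)` with `V̄.Hm = c(V.Hm)`

See the file header for the verdict on S-c and the repair census.  Everything below is a theorem; nothing is asserted about Liu's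
objects; no inhabitant of the (c)+(d) socket is claimed.

## References
* G. Shimura, *Introduction to the arithmetic theory of automorphic functions* (1971), §7.2–7.3 (ball quotients attached to hermitian
  forms over CM fields; the quotient depends on the complex form and the complex group only). [Shimura1971]
* Tree: `Literature/NumberTheory/Automorphic/PicardCMUniverse` (`PicardCode`, `ofHermitian_E ∕ _H_map ∕ _Γ_map`),
  `CorCM/HermSpaceRelabel` (`HermSpace3.relabel_map_ι`, `Level.map_ι_relabel_Γ`), `CorCM/PortJoin/Universe` (`toPkg ∕ ofPkg`).
-/

noncomputable section

open NumberField
open Literature.NumberTheory.Automorphic (cmConjRingHom cmConjRingHom_apply embedding_cmConjRingHom)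
open Literature.NumberTheory.Automorphic.PicardCM
open Literature.AlgebraicGeometry.HodgeTheory (exists_isReal_hodgeModel hodgePQ_independent_of_hodgeModel)

namespace Summit.HodgeConjecture.CorCM.D2Bridge

/-! ## §1  A Picard code is determined by its field, its complex Gram matrix and its complex group -/

/-- **Extensionality of Picard codes through `ℂ`.**  Two codes with the same code field `E ⊆ ℂ`, the same Gram matrix read in `ℂ`
(`H.map E.subtype`) and the same arithmetic group read in `GL₃(ℂ)` are EQUAL (the remaining fields are propositions; `E.subtype` and
`GL₃(E) → GL₃(ℂ)` are injective). [folklore] -/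
theorem picardCode_eq_of_complex_data (c c' : PicardCode) (hE : c.E = c'.E)
    (hH : c.H.map c.E.subtype = c'.H.map c'.E.subtype)
    (hΓ : c.Γ.map (Matrix.GeneralLinearGroup.map (c.E.subtype : c.E →+* ℂ)) =
      c'.Γ.map (Matrix.GeneralLinearGroup.map (c'.E.subtype : c'.E →+* ℂ))) : c = c' := by
  obtain ⟨E, H, Γ, _, _, _, _, _⟩ := c
  obtain ⟨E', H', Γ', _, _, _, _, _⟩ := c'
  change E = E' at hE
  subst hE
  change H.map E.subtype = H'.map E.subtype at hH
  change Γ.map (Matrix.GeneralLinearGroup.map (E.subtype : E →+* ℂ)) =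
    Γ'.map (Matrix.GeneralLinearGroup.map (E.subtype : E →+* ℂ)) at hΓ
  have hinjS : Function.Injective (E.subtype : E →+* ℂ) := Subtype.val_injective
  have hHeq : H = H' := Matrix.ext fun i j => hinjS (congrFun (congrFun hH i) j)
  have hinjG : Function.Injective (Matrix.GeneralLinearGroup.map (n := Fin 3) (E.subtype : E →+* ℂ)) := by
    intro g g' hgg'
    refine Matrix.GeneralLinearGroup.ext fun i j => hinjS ?_
    have hij := congrArg (fun x : GL (Fin 3) ℂ => (x : Matrix (Fin 3) (Fin 3) ℂ) i j) hgg'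
    simpa only [Matrix.GeneralLinearGroup.map_apply] using hij
  have hΓeq : Γ = Γ' := Subgroup.map_injective hinjG hΓ
  subst hHeq hΓeq
  rfl

/-! ## §2  The criterion for the codes `pmsCode` of hermitian data, across fields — tree copy and ported copy -/

/-- **Tree copy (`CorCM.Model.pmsCode`).**  Hermitian data `(L, ι, V, Γ)` and `(L', ι', V', Γ')` with the same code field
`ι(L) = ι'(L') ⊆ ℂ`, the same complex Gram matrix `V.Hm^{ι} = V'.Hm^{ι'}` and the same complex group `ι(Γ) = ι'(Γ')` have the SAME
Picard code. [folklore] -/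
theorem pmsCode_eq_of_complex_data {L L' : CMField} {ι : L →+* ℂ} {ι' : L' →+* ℂ}
    (V : HermSpace3 L ι) (V' : HermSpace3 L' ι') (Γ : Level V) (Γ' : Level V')
    (hE : ι.fieldRange = ι'.fieldRange) (hH : V.Hm.map ι = V'.Hm.map ι')
    (hΓ : Γ.Γ.map (Matrix.GeneralLinearGroup.map ι) = Γ'.Γ.map (Matrix.GeneralLinearGroup.map ι')) :
    Model.pmsCode L ι V Γ = Model.pmsCode L' ι' V' Γ' :=
  picardCode_eq_of_complex_data _ _ hE
    ((PicardCode.ofHermitian_H_map ι V.Hm Γ.Γ V.isHermitian V.signature_ι₁ V.posDef_of_ne Γ.isCongruence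
        Γ.torsionFree).trans
      (hH.trans (PicardCode.ofHermitian_H_map ι' V'.Hm Γ'.Γ V'.isHermitian V'.signature_ι₁ V'.posDef_of_ne
        Γ'.isCongruence Γ'.torsionFree).symm))
    ((PicardCode.ofHermitian_Γ_map ι V.Hm Γ.Γ V.isHermitian V.signature_ι₁ V.posDef_of_ne Γ.isCongruence
        Γ.torsionFree).trans
      (hΓ.trans (PicardCode.ofHermitian_Γ_map ι' V'.Hm Γ'.Γ V'.isHermitian V'.signature_ι₁ V'.posDef_of_ne
        Γ'.isCongruence Γ'.torsionFree).symm))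

/-- **Ported copy (`HodgeCM.Model.pmsCode`, the END's currency).**  Same statement for `HodgeCM.HermSpace3 ∕ HodgeCM.Level`. [folklore] -/
theorem pkg_pmsCode_eq_of_complex_data {L L' : HodgeCM.CMField} {ι : (L : Type) →+* ℂ} {ι' : (L' : Type) →+* ℂ}
    (V : HodgeCM.HermSpace3 L ι) (V' : HodgeCM.HermSpace3 L' ι') (Γ : HodgeCM.Level V) (Γ' : HodgeCM.Level V')
    (hE : ι.fieldRange = ι'.fieldRange) (hH : V.Hm.map ι = V'.Hm.map ι')
    (hΓ : Γ.Γ.map (Matrix.GeneralLinearGroup.map ι) = Γ'.Γ.map (Matrix.GeneralLinearGroup.map ι')) :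
    HodgeCM.Model.pmsCode L ι V Γ = HodgeCM.Model.pmsCode L' ι' V' Γ' :=
  picardCode_eq_of_complex_data _ _ hE
    ((PicardCode.ofHermitian_H_map ι V.Hm Γ.Γ V.isHermitian V.signature_ι₁ V.posDef_of_ne Γ.isCongruence
        Γ.torsionFree).trans
      (hH.trans (PicardCode.ofHermitian_H_map ι' V'.Hm Γ'.Γ V'.isHermitian V'.signature_ι₁ V'.posDef_of_ne
        Γ'.isCongruence Γ'.torsionFree).symm))
    ((PicardCode.ofHermitian_Γ_map ι V.Hm Γ.Γ V.isHermitian V.signature_ι₁ V.posDef_of_ne Γ.isCongruence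
        Γ.torsionFree).trans
      (hΓ.trans (PicardCode.ofHermitian_Γ_map ι' V'.Hm Γ'.Γ V'.isHermitian V'.signature_ι₁ V'.posDef_of_ne
        Γ'.isCongruence Γ'.torsionFree).symm))

/-- **Hence the SAME variety of the model universe**: `U.pms L ι V Γ = U.pms L' ι' V' Γ'` for `U := HodgeCM.Model.universeOf hHD hI hU h₃`
(so the realised surfaces `Var.scheme hU h₃ (U.pms …)`, their cohomology `U.CohC … k` and every code-indexed datum coincide). [folklore] -/
theorem pkg_pms_eq_of_complex_data (hHD : exists_isReal_hodgeModel) (hI : hodgePQ_independent_of_hodgeModel)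
    (hU : BallQuotientUniformisedDatum) (h₃ : CMAbelianVarietyRealised)
    {L L' : HodgeCM.CMField} {ι : (L : Type) →+* ℂ} {ι' : (L' : Type) →+* ℂ}
    (V : HodgeCM.HermSpace3 L ι) (V' : HodgeCM.HermSpace3 L' ι') (Γ : HodgeCM.Level V) (Γ' : HodgeCM.Level V')
    (hE : ι.fieldRange = ι'.fieldRange) (hH : V.Hm.map ι = V'.Hm.map ι')
    (hΓ : Γ.Γ.map (Matrix.GeneralLinearGroup.map ι) = Γ'.Γ.map (Matrix.GeneralLinearGroup.map ι')) :
    (HodgeCM.Model.universeOf hHD hI hU h₃).pms L ι V Γ = (HodgeCM.Model.universeOf hHD hI hU h₃).pms L' ι' V' Γ' :=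
  congrArg Var.pms (pkg_pmsCode_eq_of_complex_data V V' Γ Γ' hE hH hΓ)

/-! ## §3  Relabelling along `h : L ≃+* L` does not change the code (literal form of `TowerRelabel.exists_hom_pms_relabel`) -/

/-- The code field of `ι₁ ∘ h⁻¹` is that of `ι₁` (`h` is onto). [folklore] -/
theorem fieldRange_comp_symm {L : CMField} (ι₁ : L →+* ℂ) (h : (L : Type) ≃+* L) :
    (ι₁.comp h.symm.toRingHom).fieldRange = ι₁.fieldRange := by
  ext x
  simp only [RingHom.mem_fieldRange, RingHom.coe_comp, Function.comp_apply]
  constructor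
  · rintro ⟨y, rfl⟩
    exact ⟨h.symm.toRingHom y, rfl⟩
  · rintro ⟨y, rfl⟩
    exact ⟨h y, by simp⟩

/-- **Relabelling invariance of the Picard code**: `pmsCode L (ι₁ ∘ h⁻¹) (h V) (h Γ) = pmsCode L ι₁ V Γ` for every `h : L ≃+* L`
(`HermSpace3.relabel_map_ι`: same complex Gram matrix; `Level.map_ι_relabel_Γ`: same complex group).  Consequently the relabelled tower's
surfaces ARE the original ones — not merely isomorphic. [folklore] -/
theorem pmsCode_relabel {L : CMField} {ι₁ : L →+* ℂ} (V : HermSpace3 L ι₁) (Γ : Level V) (h : (L : Type) ≃+* L) :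
    Model.pmsCode L (ι₁.comp h.symm.toRingHom) (V.relabel h) (Γ.relabel h) = Model.pmsCode L ι₁ V Γ :=
  pmsCode_eq_of_complex_data _ _ _ _ (fieldRange_comp_symm ι₁ h) (HermSpace3.relabel_map_ι V h)
    (Level.map_ι_relabel_Γ Γ h)

/-! ## §4  The conjugate presentation `(V̄, ῑ₁)` with `V̄.Hm = c(V.Hm)`, `Γ̄ = c(Γ)`, in the END's currency -/

/-- `conj ∘ ι₁ ∘ c = ι₁` on a CM field: the conjugate embedding composed with complex conjugation of `L` is `ι₁`. [folklore] -/
theorem starRingEnd_comp_comp_cmConj {L : Type} [Field L] [NumberField L] [IsCMField L] (ι₁ : L →+* ℂ) :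
    ((starRingEnd ℂ).comp ι₁).comp (cmConjRingHom L) = ι₁ := by
  ext x
  simp only [RingHom.coe_comp, Function.comp_apply, embedding_cmConjRingHom, starRingEnd_self_apply]

/-- The code field of `ῑ₁ = conj ∘ ι₁` is that of `ι₁` (a CM field's image in `ℂ` is stable under complex conjugation). [folklore] -/
theorem fieldRange_starRingEnd_comp {L : Type} [Field L] [NumberField L] [IsCMField L] (ι₁ : L →+* ℂ) :
    ((starRingEnd ℂ).comp ι₁).fieldRange = ι₁.fieldRange := by
  ext x
  simp only [RingHom.mem_fieldRange, RingHom.coe_comp, Function.comp_apply]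
  constructor
  · rintro ⟨y, rfl⟩
    exact ⟨cmConjRingHom L y, embedding_cmConjRingHom L ι₁ y⟩
  · rintro ⟨y, rfl⟩
    refine ⟨cmConjRingHom L y, ?_⟩
    rw [embedding_cmConjRingHom, starRingEnd_self_apply]

/-- Transposed-conjugate Gram matrix, read through `ῑ₁`, is the original one read through `ι₁`: `(c H)^{ῑ₁} = H^{ι₁}`. [folklore] -/
theorem map_starRingEnd_comp_of_eq_map_cmConj {L : Type} [Field L] [NumberField L] [IsCMField L] (ι₁ : L →+* ℂ)
    {H H' : Matrix (Fin 3) (Fin 3) L} (hH : H' = H.map (cmConjRingHom L)) :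
    H'.map ((starRingEnd ℂ).comp ι₁) = H.map ι₁ := by
  rw [hH, Matrix.map_map]
  exact congrArg H.map (congrArg (fun f : L →+* ℂ => (f : L → ℂ)) (starRingEnd_comp_comp_cmConj ι₁))

/-- Conjugated group, read through `ῑ₁`, is the original one read through `ι₁`: `ῑ₁(c Γ) = ι₁(Γ)`. [folklore] -/
theorem subgroupMap_starRingEnd_comp_of_eq_map_cmConj {L : Type} [Field L] [NumberField L] [IsCMField L] (ι₁ : L →+* ℂ)
    {Γ Γ' : Subgroup (GL (Fin 3) L)} (hΓ : Γ' = Γ.map (Matrix.GeneralLinearGroup.map (cmConjRingHom L))) :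
    Γ'.map (Matrix.GeneralLinearGroup.map ((starRingEnd ℂ).comp ι₁)) = Γ.map (Matrix.GeneralLinearGroup.map ι₁) := by
  rw [hΓ, Subgroup.map_map, ← Matrix.GeneralLinearGroup.map_comp, starRingEnd_comp_comp_cmConj]

/-- **The conjugate presentation has the same Picard code** (END currency): for ANY `V' : HodgeCM.HermSpace3 L ῑ₁` and `Γ' : HodgeCM.Level V'`
carrying the transposed-conjugate data `V'.Hm = c(V.Hm)`, `Γ'.Γ = c(Γ.Γ)`, `pmsCode L ῑ₁ V' Γ' = pmsCode L ι₁ V Γ`. [folklore] -/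
theorem pkg_pmsCode_conj {L : HodgeCM.CMField} {ι₁ : (L : Type) →+* ℂ} (V : HodgeCM.HermSpace3 L ι₁) (Γ : HodgeCM.Level V)
    (V' : HodgeCM.HermSpace3 L ((starRingEnd ℂ).comp ι₁)) (Γ' : HodgeCM.Level V')
    (hH : V'.Hm = V.Hm.map (cmConjRingHom (L : Type)))
    (hΓ : Γ'.Γ = Γ.Γ.map (Matrix.GeneralLinearGroup.map (cmConjRingHom (L : Type)))) :
    HodgeCM.Model.pmsCode L ((starRingEnd ℂ).comp ι₁) V' Γ' = HodgeCM.Model.pmsCode L ι₁ V Γ :=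
  pkg_pmsCode_eq_of_complex_data V' V Γ' Γ (fieldRange_starRingEnd_comp ι₁) (map_starRingEnd_comp_of_eq_map_cmConj ι₁ hH)
    (subgroupMap_starRingEnd_comp_of_eq_map_cmConj ι₁ hΓ)

/-- **… hence the SAME surface of the model universe**: `U.pms L ῑ₁ V' Γ' = U.pms L ι₁ V Γ` — the `(V̄, ῑ₁)`-tower's surface at `Γ̄` IS the
`(V, ι₁)`-tower's surface at `Γ` (same `Var`, same realised scheme, same `CohC`). [folklore] -/
theorem pkg_pms_conj (hHD : exists_isReal_hodgeModel) (hI : hodgePQ_independent_of_hodgeModel)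
    (hU : BallQuotientUniformisedDatum) (h₃ : CMAbelianVarietyRealised)
    {L : HodgeCM.CMField} {ι₁ : (L : Type) →+* ℂ} (V : HodgeCM.HermSpace3 L ι₁) (Γ : HodgeCM.Level V)
    (V' : HodgeCM.HermSpace3 L ((starRingEnd ℂ).comp ι₁)) (Γ' : HodgeCM.Level V')
    (hH : V'.Hm = V.Hm.map (cmConjRingHom (L : Type)))
    (hΓ : Γ'.Γ = Γ.Γ.map (Matrix.GeneralLinearGroup.map (cmConjRingHom (L : Type)))) :
    (HodgeCM.Model.universeOf hHD hI hU h₃).pms L ((starRingEnd ℂ).comp ι₁) V' Γ' =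
      (HodgeCM.Model.universeOf hHD hI hU h₃).pms L ι₁ V Γ :=
  congrArg Var.pms (pkg_pmsCode_conj V Γ V' Γ' hH hΓ)

/-- `ι₁ ∘ c⁻¹ = conj ∘ ι₁` for the complex conjugation `c` of a CM field (`c` is an involution commuting with every embedding). [folklore] -/
theorem comp_complexConj_symm_eq_starRingEnd_comp {L : Type} [Field L] [NumberField L] [IsCMField L] (ι₁ : L →+* ℂ) :
    ι₁.comp (IsCMField.complexConj L).toRingEquiv.symm.toRingHom = (starRingEnd ℂ).comp ι₁ := by
  ext x
  obtain ⟨y, rfl⟩ := (IsCMField.complexConj L).toRingEquiv.surjective x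
  change ι₁ ((IsCMField.complexConj L).toRingEquiv.symm ((IsCMField.complexConj L).toRingEquiv y)) =
    starRingEnd ℂ (ι₁ (cmConjRingHom L y))
  rw [RingEquiv.symm_apply_apply, embedding_cmConjRingHom, starRingEnd_self_apply]

/-- **Non-vacuity of §4's hypotheses**: a conjugate presentation `(V', Γ')` with `V'.Hm = c(V.Hm)`, `Γ'.Γ = c(Γ.Γ)` EXISTS for every
`(V, Γ)` — namely the tree's `HermSpace3.relabel ∕ Level.relabel` at `h := c` (through the PORT JOIN maps), moved from the index
`ι₁ ∘ c⁻¹` to the literal `conj ∘ ι₁`. [folklore] -/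
theorem exists_conjPresentation {L : HodgeCM.CMField} {ι₁ : (L : Type) →+* ℂ} (V : HodgeCM.HermSpace3 L ι₁) (Γ : HodgeCM.Level V) :
    ∃ (V' : HodgeCM.HermSpace3 L ((starRingEnd ℂ).comp ι₁)) (Γ' : HodgeCM.Level V'),
      V'.Hm = V.Hm.map (cmConjRingHom (L : Type)) ∧
        Γ'.Γ = Γ.Γ.map (Matrix.GeneralLinearGroup.map (cmConjRingHom (L : Type))) := by
  have key : ∀ (ι : (L : Type) →+* ℂ), ι₁.comp (IsCMField.complexConj (L : Type)).toRingEquiv.symm.toRingHom = ι →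
      ∃ (V' : HodgeCM.HermSpace3 L ι) (Γ' : HodgeCM.Level V'),
        V'.Hm = V.Hm.map (cmConjRingHom (L : Type)) ∧
          Γ'.Γ = Γ.Γ.map (Matrix.GeneralLinearGroup.map (cmConjRingHom (L : Type))) := by
    rintro _ rfl
    exact ⟨PortJoin.HermSpace3.toPkg ((PortJoin.HermSpace3.ofPkg V).relabel (IsCMField.complexConj (L : Type)).toRingEquiv),
      PortJoin.Level.toPkg ((PortJoin.Level.ofPkg Γ).relabel (IsCMField.complexConj (L : Type)).toRingEquiv), rfl, rfl⟩
  exact key _ (comp_complexConj_symm_eq_starRingEnd_comp ι₁)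

/-! ## §5  The instance-hypothesis dictionary between the J value (prove-5) and its consumer (prove-3) -/

/-- `(algebraMap L ℂ) ∘ c = ι₁` iff `algebraMap L ℂ = conj ∘ ι₁` pointwise: prove-5's `hι` (`ComponentAlbanesePin`) is prove-3's
`hinst` at `ιg := ῑ₁` (`HcmPiecesAtPin`); both files are generic in ONE ambient `[Algebra L ℂ]`, so the J value feeds the consumer with
no transport of `ComponentAlbanese` at all. [folklore] -/
theorem algebraMap_comp_cmConj_eq_iff {L : Type} [Field L] [NumberField L] [IsCMField L] [Algebra L ℂ] (ι₁ : L →+* ℂ) :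
    (algebraMap L ℂ).comp (cmConjRingHom L) = ι₁ ↔ ∀ x : L, algebraMap L ℂ x = ((starRingEnd ℂ).comp ι₁) x := by
  constructor
  · intro h x
    have hx := RingHom.congr_fun h (cmConjRingHom L x)
    rw [RingHom.coe_comp, Function.comp_apply, cmConjRingHom_apply, cmConjRingHom_apply,
      IsCMField.complexConj_apply_apply] at hx
    rw [hx, RingHom.coe_comp, Function.comp_apply, ← cmConjRingHom_apply, embedding_cmConjRingHom]
  · intro h
    ext x
    rw [RingHom.coe_comp, Function.comp_apply, h, RingHom.coe_comp, Function.comp_apply, embedding_cmConjRingHom,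
      starRingEnd_self_apply]

end Summit.HodgeConjecture.CorCM.D2Bridge

end
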